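import Summits.NavierStokesRegularity.FunctionalMining.VelocityL6CubeRoot
import Summits.NavierStokesRegularity.FunctionalMining.VelocityL4NonlinearPoincare
import HarnessLib

/-!
# FunctionalMining — the EXPLICIT nonlinear Poincaré inequality at `a = 2`:
# `∫|u|⁶ ≤ 39420 d³ ∫|u|⁴|∇u|²` for zero-mean fields on `T^d`

search for candidate a priori estimates; no regularity claim. Cell `pub-nsfunc`, prove seat
(gen 8). A static functional inequality; nothing about Navier–Stokes solutions. Case `a = 2` of the
no-go seat's Lemma NP (SIEVELD.md §3.1, there by compactness), the coercive step of the `L⁶`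
velocity-moment law (K0 row `EV.s=6|T_LD|G1`), by the constructive argument of
`VelocityL4NonlinearPoincare` (case `a = 1`): with `W := ‖u‖²u` (`∫‖W‖² = ∫‖u‖⁶`) and the
`⅓`-Hölder inverse map `g(w) = ‖w‖^{1/3} w/‖w‖` (`VelocityL6CubeRoot`), `∫ u = 0` gives
`‖∫W‖² ≤ 729 ∫‖W − ∫W‖²`, hence `∫‖W‖² ≤ 1460 ∫‖W − ∫W‖²`; the oscillation is controlled by
Poincaré–Wirtinger applied to the POLYNOMIAL (hence smooth) regularisation `W_ε := (‖u‖² + ε) u`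
(`∑ₖ‖∂ₖW_ε‖² ≤ 9(‖u‖²+ε)²∑ₖ‖∂ₖu‖²`, `‖W_ε − W‖ = ε‖u‖`), and `ε → 0`.

* `integral_norm_pow_six_le_weighted` : `∫‖u‖⁶ ≤ 39420 d³ ∫‖u‖⁴∑ₖ‖∂ₖu‖²` for smooth zero-mean `u`.
[ours; elementary]
-/

noncomputable section

open MeasureTheory Finset
open scoped InnerProductSpace RealInnerProductSpace ContDiff

namespace Summit.NavierStokesRegularity.FunctionalMining

open Literature.Analysis.FunctionSpaces Literature.Analysis.FunctionSpaces.Torus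

namespace VelocityL6

variable {d : Type*} [Fintype d] [DecidableEq d]

/-! ## 1. The regularisation `W_ε = (‖u‖² + ε) u` -/

omit [DecidableEq d] in
/-- `W_ε = (‖u‖² + ε) u` is smooth. [folklore] -/
theorem isSmooth_reg2 {u : UnitAddTorus d → EuclideanSpace ℝ d} (hu : IsSmooth u) (ε : ℝ) :
    IsSmooth (fun x => (‖u x‖ ^ 2 + ε) • u x) :=
  ((hu.norm_sq).add (isSmooth_const ε)).smul' hu

omit [Fintype d] in
/-- Partial derivatives of constants vanish. [folklore] -/
private theorem partialDeriv_const_apply' {F : Type*} [NormedAddCommGroup F]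
    [NormedSpace ℝ F] (c : F) (l : d) (x : UnitAddTorus d) :
    partialDeriv l (fun _ : UnitAddTorus d => c) x = 0 := by
  simp [Torus.partialDeriv, Torus.lineDeriv]

/-- `∂ₖ(‖u‖² + ε) = 2⟪u, ∂ₖu⟫`. [folklore] -/
theorem partialDeriv_normSq_add {u : UnitAddTorus d → EuclideanSpace ℝ d} (hu : IsSmooth u)
    (ε : ℝ) (k : d) (x : UnitAddTorus d) :
    partialDeriv k (fun y => ‖u y‖ ^ 2 + ε) x = 2 * ⟪u x, partialDeriv k u x⟫ := by
  have hu1 : IsContDiff 1 u := hu.isContDiff (by simp)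
  have e : (fun y => ‖u y‖ ^ 2 + ε) = (fun y => ⟪u y, u y⟫) + fun _ => ε := by
    funext y; simp only [Pi.add_apply, real_inner_self_eq_norm_sq]
  have hcst : IsContDiff 1 (fun _ : UnitAddTorus d => ε) := contDiff_const
  have hinn : IsContDiff 1 (fun y => ⟪u y, u y⟫) := ContDiff.inner ℝ hu1 hu1
  rw [e, partialDeriv_add hinn hcst, Pi.add_apply, partialDeriv_inner hu1 hu1,
    partialDeriv_const_apply', add_zero, real_inner_comm (partialDeriv k u x) (u x)]
  ring

/-- Derivative bound: `‖∂ₖW_ε‖ ≤ 3 (‖u‖² + ε) ‖∂ₖu‖` for `ε ≥ 0`. [ours] -/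
theorem norm_partialDeriv_reg2_le {u : UnitAddTorus d → EuclideanSpace ℝ d} (hu : IsSmooth u)
    {ε : ℝ} (hε : 0 ≤ ε) (k : d) (x : UnitAddTorus d) :
    ‖partialDeriv k (fun y => (‖u y‖ ^ 2 + ε) • u y) x‖ ≤
      3 * (‖u x‖ ^ 2 + ε) * ‖partialDeriv k u x‖ := by
  have hθ : IsContDiff 1 (fun y => ‖u y‖ ^ 2 + ε) :=
    ((hu.norm_sq).add (isSmooth_const ε)).isContDiff (by simp)
  have hu1 : IsContDiff 1 u := hu.isContDiff (by simp)
  rw [partialDeriv_smul hθ hu1, partialDeriv_normSq_add hu ε]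
  have h1 : ‖(‖u x‖ ^ 2 + ε) • partialDeriv k u x‖ = (‖u x‖ ^ 2 + ε) * ‖partialDeriv k u x‖ := by
    rw [norm_smul, Real.norm_of_nonneg (by positivity)]
  have h2 : ‖(2 * ⟪u x, partialDeriv k u x⟫) • u x‖ ≤ 2 * (‖u x‖ ^ 2 * ‖partialDeriv k u x‖) := by
    rw [norm_smul, Real.norm_eq_abs, abs_mul, abs_of_pos (by norm_num : (0 : ℝ) < 2)]
    have hcs : |⟪u x, partialDeriv k u x⟫| ≤ ‖u x‖ * ‖partialDeriv k u x‖ :=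
      abs_real_inner_le_norm _ _
    calc 2 * |⟪u x, partialDeriv k u x⟫| * ‖u x‖ ≤ 2 * (‖u x‖ * ‖partialDeriv k u x‖) * ‖u x‖ := by
          gcongr
      _ = 2 * (‖u x‖ ^ 2 * ‖partialDeriv k u x‖) := by ring
  have h3 : 0 ≤ ε * ‖partialDeriv k u x‖ := by positivity
  calc ‖(‖u x‖ ^ 2 + ε) • partialDeriv k u x + (2 * ⟪u x, partialDeriv k u x⟫) • u x‖
      ≤ ‖(‖u x‖ ^ 2 + ε) • partialDeriv k u x‖ + ‖(2 * ⟪u x, partialDeriv k u x⟫) • u x‖ :=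
        norm_add_le _ _
    _ ≤ (‖u x‖ ^ 2 + ε) * ‖partialDeriv k u x‖ + 2 * (‖u x‖ ^ 2 * ‖partialDeriv k u x‖) := by
        rw [h1]; gcongr
    _ ≤ 3 * (‖u x‖ ^ 2 + ε) * ‖partialDeriv k u x‖ := by nlinarith

/-- `gradNormSq W_ε ≤ 9 ∫ (‖u‖² + ε)² ∑ₖ‖∂ₖu‖²` for `ε ≥ 0`. [ours] -/
theorem gradNormSq_reg2_le {u : UnitAddTorus d → EuclideanSpace ℝ d} (hu : IsSmooth u)
    {ε : ℝ} (hε : 0 ≤ ε) :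
    gradNormSq (fun y => (‖u y‖ ^ 2 + ε) • u y) ≤
      9 * ∫ x, (‖u x‖ ^ 2 + ε) ^ 2 * ∑ k, ‖partialDeriv k u x‖ ^ 2 := by
  unfold gradNormSq
  have hW := isSmooth_reg2 hu ε
  have hc1 : Continuous fun x => ∑ k, ‖partialDeriv k (fun y => (‖u y‖ ^ 2 + ε) • u y) x‖ ^ 2 :=
    continuous_finsetSum _ fun k _ => (hW.partialDeriv k).continuous.norm.pow 2
  have hc2 : Continuous fun x => (‖u x‖ ^ 2 + ε) ^ 2 * ∑ k, ‖partialDeriv k u x‖ ^ 2 :=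
    (((hu.continuous.norm.pow 2).add continuous_const).pow 2).mul
      (continuous_finsetSum _ fun k _ => (hu.partialDeriv k).continuous.norm.pow 2)
  rw [← integral_const_mul]
  refine integral_mono hc1.integrable_unitAddTorus (hc2.integrable_unitAddTorus.const_mul 9)
    fun x => ?_
  simp only
  rw [Finset.mul_sum, Finset.mul_sum]
  refine Finset.sum_le_sum fun k _ => ?_
  have h := norm_partialDeriv_reg2_le hu hε k x
  have h0 : 0 ≤ ‖partialDeriv k (fun y => (‖u y‖ ^ 2 + ε) • u y) x‖ := norm_nonneg _
  calc ‖partialDeriv k (fun y => (‖u y‖ ^ 2 + ε) • u y) x‖ ^ 2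
      ≤ (3 * (‖u x‖ ^ 2 + ε) * ‖partialDeriv k u x‖) ^ 2 := pow_le_pow_left₀ h0 h 2
    _ = 9 * ((‖u x‖ ^ 2 + ε) ^ 2 * ‖partialDeriv k u x‖ ^ 2) := by ring

/-! ## 2. The nonlinear Poincaré inequality at `a = 2` -/

/-- **Explicit nonlinear Poincaré inequality, `a = 2` (SIEVELD Lemma NP).** For every smooth
zero-mean vector field `u` on the flat torus `T^d`,
`∫ ‖u‖⁶ ≤ 39420 · d³ · ∫ ‖u‖⁴ ∑ₖ ‖∂ₖu‖²`
(`39420 = 1460 · 3 · 9`: mean control `1460`, three-term splitting `3`, regularised gradient `9`,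
Poincaré–Wirtinger `d³`). [ours; elementary] -/
theorem integral_norm_pow_six_le_weighted {u : UnitAddTorus d → EuclideanSpace ℝ d}
    (hu : IsSmooth u) (h0 : HasZeroMean u) :
    ∫ x, ‖u x‖ ^ 6 ≤
      39420 * (Fintype.card d : ℝ) ^ 3 * ∫ x, ‖u x‖ ^ 4 * ∑ k, ‖partialDeriv k u x‖ ^ 2 := by
  set W : UnitAddTorus d → EuclideanSpace ℝ d := fun x => ‖u x‖ ^ 2 • u x with hW
  set c : EuclideanSpace ℝ d := ∫ x, W x with hc
  obtain ⟨I, hI⟩ : ∃ I : ℝ, I = ∫ x, ‖u x‖ ^ 4 * ∑ k, ‖partialDeriv k u x‖ ^ 2 := ⟨_, rfl⟩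
  obtain ⟨J, hJ⟩ : ∃ J : ℝ, J = ∫ x, ‖u x‖ ^ 2 * ∑ k, ‖partialDeriv k u x‖ ^ 2 := ⟨_, rfl⟩
  obtain ⟨K, hK⟩ : ∃ K : ℝ, K = ∫ x, ‖u x‖ ^ 2 := ⟨_, rfl⟩
  obtain ⟨Z, hZ⟩ : ∃ Z : ℝ, Z = gradNormSq u := ⟨_, rfl⟩
  obtain ⟨D3, hD3⟩ : ∃ D : ℝ, D = (Fintype.card d : ℝ) ^ 3 := ⟨_, rfl⟩
  rw [← hI, ← hD3]
  have huc : Continuous u := hu.continuous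
  have hWc : Continuous W := (huc.norm.pow 2).smul huc
  have h0' : ∫ x, u x = 0 := h0
  have hcs : Continuous fun x => ∑ k, ‖partialDeriv k u x‖ ^ 2 :=
    continuous_finsetSum _ fun k _ => (hu.partialDeriv k).continuous.norm.pow 2
  have hI0 : 0 ≤ I := by rw [hI]; exact integral_nonneg fun x => by positivity
  have hJ0 : 0 ≤ J := by rw [hJ]; exact integral_nonneg fun x => by positivity
  have hK0 : 0 ≤ K := by rw [hK]; exact integral_nonneg fun x => by positivity
  have hZ0 : 0 ≤ Z := by rw [hZ]; exact gradNormSq_nonneg u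
  have hD30 : 0 ≤ D3 := by rw [hD3]; positivity
  -- `U = ∫‖W‖²`
  have hU : ∫ x, ‖u x‖ ^ 6 = ∫ x, ‖W x‖ ^ 2 := by
    refine integral_congr_ae (ae_of_all _ fun x => ?_)
    simp only [hW, norm_smul, Real.norm_of_nonneg (sq_nonneg _)]; ring
  -- mean control
  set V : ℝ := ∫ x, ‖W x - c‖ ^ 2 with hV
  have hmean : ‖c‖ ^ 2 ≤ 729 * V := norm_sq_integral_normSq_smul_le huc h0'
  have hUV : ∫ x, ‖W x‖ ^ 2 ≤ 1460 * V := by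
    have hpt : ∀ x, ‖W x‖ ^ 2 ≤ 2 * ‖W x - c‖ ^ 2 + 2 * ‖c‖ ^ 2 := by
      intro x
      have h := norm_add_le (W x - c) c
      rw [sub_add_cancel] at h
      have h2 : ‖W x‖ ^ 2 ≤ (‖W x - c‖ + ‖c‖) ^ 2 := pow_le_pow_left₀ (norm_nonneg _) h 2
      nlinarith [sq_nonneg (‖W x - c‖ - ‖c‖)]
    have hcV : Continuous fun x => ‖W x - c‖ ^ 2 := (hWc.sub continuous_const).norm.pow 2
    have hiV : Integrable (fun x => 2 * ‖W x - c‖ ^ 2) volume :=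
      (hcV.const_mul 2).integrable_unitAddTorus
    have hic : Integrable (fun _ : UnitAddTorus d => 2 * ‖c‖ ^ 2) volume := integrable_const _
    have hiW : Integrable (fun x => ‖W x‖ ^ 2) volume := (hWc.norm.pow 2).integrable_unitAddTorus
    calc ∫ x, ‖W x‖ ^ 2 ≤ ∫ x, (2 * ‖W x - c‖ ^ 2 + 2 * ‖c‖ ^ 2) :=
          integral_mono hiW (hiV.add hic) hpt
      _ = 2 * V + 2 * ‖c‖ ^ 2 := by
          rw [integral_add hiV hic, integral_const_mul, integral_const]
          simp [hV]
      _ ≤ 1460 * V := by linarith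
  -- oscillation for every `0 < ε ≤ 1`
  have hVε : ∀ ε : ℝ, 0 < ε → ε ≤ 1 → V ≤ 27 * D3 * I + ε * (6 * K + 27 * D3 * (2 * J + Z)) := by
    intro ε hε hε1
    set Wε : UnitAddTorus d → EuclideanSpace ℝ d := fun x => (‖u x‖ ^ 2 + ε) • u x with hWε
    set cε : EuclideanSpace ℝ d := ∫ x, Wε x with hcε
    have hWεs : IsSmooth Wε := isSmooth_reg2 hu ε
    have hWεc : Continuous Wε := hWεs.continuous
    -- (a) `∫‖Wε − W‖² = ε² K ≤ ε K`
    have ha : ∫ x, ‖Wε x - W x‖ ^ 2 ≤ ε * K := by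
      have hpt : ∀ x, ‖Wε x - W x‖ ^ 2 = ε ^ 2 * ‖u x‖ ^ 2 := by
        intro x
        simp only [hWε, hW]
        rw [← sub_smul, add_sub_cancel_left, norm_smul, Real.norm_of_nonneg hε.le]; ring
      have e : ∫ x, ‖Wε x - W x‖ ^ 2 = ε ^ 2 * K := by
        rw [hK, ← integral_const_mul]
        exact integral_congr_ae (ae_of_all _ hpt)
      rw [e]
      have : ε ^ 2 ≤ ε := by nlinarith
      exact mul_le_mul_of_nonneg_right this hK0
    -- (b) `‖cε − c‖² ≤ ε K`
    have hb : ‖cε - c‖ ^ 2 ≤ ε * K := by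
      have e : cε - c = ∫ x, (Wε x - W x) := by
        rw [hcε, hc, integral_sub hWεc.integrable_unitAddTorus hWc.integrable_unitAddTorus]
      have h1 : ‖cε - c‖ ≤ ∫ x, ‖Wε x - W x‖ := by rw [e]; exact norm_integral_le_integral_norm _
      have h2 : ∫ x, ‖Wε x - W x‖ ≤ Real.sqrt (∫ x, ‖Wε x - W x‖ ^ 2) :=
        VelocityL4.integral_le_sqrt_integral_sq (hWεc.sub hWc).norm
      have h3 : 0 ≤ ∫ x, ‖Wε x - W x‖ ^ 2 := integral_nonneg fun x => sq_nonneg _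
      calc ‖cε - c‖ ^ 2 ≤ Real.sqrt (∫ x, ‖Wε x - W x‖ ^ 2) ^ 2 :=
            pow_le_pow_left₀ (norm_nonneg _) (h1.trans h2) 2
        _ = ∫ x, ‖Wε x - W x‖ ^ 2 := Real.sq_sqrt h3
        _ ≤ ε * K := ha
    -- (c) Poincaré–Wirtinger: `∫‖Wε − cε‖² ≤ D3 · 9 (I + ε(2J + Z))`
    have hcP : ∫ x, ‖Wε x - cε‖ ^ 2 ≤ D3 * (9 * (I + ε * (2 * J + Z))) := by
      have hsm : IsSmooth (fun x => Wε x - cε) := hWεs.sub (isSmooth_const cε)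
      have hzm : HasZeroMean (fun x => Wε x - cε) := by
        show ∫ x, (Wε x - cε) = 0
        rw [integral_sub hWεc.integrable_unitAddTorus (integrable_const _), integral_const]
        simp [hcε]
      have hP := Torus.integral_norm_sq_le_card_pow_mul_gradNormSq hsm hzm
      have hg : gradNormSq (fun x => Wε x - cε) = gradNormSq Wε := by
        unfold gradNormSq
        refine integral_congr_ae (ae_of_all _ fun x => ?_)
        refine Finset.sum_congr rfl fun k _ => ?_
        have e : (fun x => Wε x - cε) = Wε + fun _ => -cε := by
          funext y; simp [sub_eq_add_neg]
        have hcst : IsContDiff 1 (fun _ : UnitAddTorus d => -cε) := contDiff_const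
        rw [e, partialDeriv_add (hWεs.isContDiff (by simp)) hcst,
          Pi.add_apply, partialDeriv_const_apply', add_zero]
      have hG : gradNormSq Wε ≤ 9 * (I + ε * (2 * J + Z)) := by
        have h := gradNormSq_reg2_le hu hε.le
        have hpt : ∀ x, (‖u x‖ ^ 2 + ε) ^ 2 * ∑ k, ‖partialDeriv k u x‖ ^ 2 ≤
            ‖u x‖ ^ 4 * ∑ k, ‖partialDeriv k u x‖ ^ 2 +
              ε * (2 * (‖u x‖ ^ 2 * ∑ k, ‖partialDeriv k u x‖ ^ 2) +
                ∑ k, ‖partialDeriv k u x‖ ^ 2) := by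
          intro x
          have hs : 0 ≤ ∑ k, ‖partialDeriv k u x‖ ^ 2 :=
            Finset.sum_nonneg fun k _ => sq_nonneg _
          have hε2 : ε ^ 2 ≤ ε := by nlinarith
          have hexp : (‖u x‖ ^ 2 + ε) ^ 2 * ∑ k, ‖partialDeriv k u x‖ ^ 2 =
              ‖u x‖ ^ 4 * ∑ k, ‖partialDeriv k u x‖ ^ 2 +
                ε * (2 * (‖u x‖ ^ 2 * ∑ k, ‖partialDeriv k u x‖ ^ 2)) +
                  ε ^ 2 * ∑ k, ‖partialDeriv k u x‖ ^ 2 := by ring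
          have hm := mul_le_mul_of_nonneg_right hε2 hs
          rw [hexp]
          linarith
        have hi1 : Integrable (fun x => ‖u x‖ ^ 4 * ∑ k, ‖partialDeriv k u x‖ ^ 2) volume :=
          ((huc.norm.pow 4).mul hcs).integrable_unitAddTorus
        have hi2 : Integrable (fun x => ‖u x‖ ^ 2 * ∑ k, ‖partialDeriv k u x‖ ^ 2) volume :=
          ((huc.norm.pow 2).mul hcs).integrable_unitAddTorus
        have hi3 : Integrable (fun x => ∑ k, ‖partialDeriv k u x‖ ^ 2) volume :=
          hcs.integrable_unitAddTorus
        have hi4 : Integrable (fun x => 2 * (‖u x‖ ^ 2 * ∑ k, ‖partialDeriv k u x‖ ^ 2) +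
            ∑ k, ‖partialDeriv k u x‖ ^ 2) volume := (hi2.const_mul 2).add hi3
        have hi5 : Integrable (fun x => ε * (2 * (‖u x‖ ^ 2 * ∑ k, ‖partialDeriv k u x‖ ^ 2) +
            ∑ k, ‖partialDeriv k u x‖ ^ 2)) volume := hi4.const_mul ε
        have hle : ∫ x, (‖u x‖ ^ 2 + ε) ^ 2 * ∑ k, ‖partialDeriv k u x‖ ^ 2 ≤
            I + ε * (2 * J + Z) := by
          calc ∫ x, (‖u x‖ ^ 2 + ε) ^ 2 * ∑ k, ‖partialDeriv k u x‖ ^ 2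
              ≤ ∫ x, (‖u x‖ ^ 4 * ∑ k, ‖partialDeriv k u x‖ ^ 2 +
                  ε * (2 * (‖u x‖ ^ 2 * ∑ k, ‖partialDeriv k u x‖ ^ 2) +
                    ∑ k, ‖partialDeriv k u x‖ ^ 2)) :=
                integral_mono ((((huc.norm.pow 2).add continuous_const).pow 2).mul
                  hcs).integrable_unitAddTorus (hi1.add hi5) hpt
            _ = I + ε * (2 * J + Z) := by
                rw [integral_add hi1 hi5, integral_const_mul, integral_add (hi2.const_mul 2) hi3,
                  integral_const_mul, ← hI, ← hJ, hZ]
                rfl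
        linarith
      calc ∫ x, ‖Wε x - cε‖ ^ 2 ≤ (Fintype.card d : ℝ) ^ 3 * gradNormSq (fun x => Wε x - cε) := hP
        _ = D3 * gradNormSq Wε := by rw [hg, hD3]
        _ ≤ D3 * (9 * (I + ε * (2 * J + Z))) := mul_le_mul_of_nonneg_left hG hD30
    -- (d) three-term splitting
    have hsplit : V ≤ 3 * (∫ x, ‖Wε x - W x‖ ^ 2) + 3 * (∫ x, ‖Wε x - cε‖ ^ 2) +
        3 * ‖cε - c‖ ^ 2 := by
      have hpt : ∀ x, ‖W x - c‖ ^ 2 ≤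
          3 * ‖Wε x - W x‖ ^ 2 + 3 * ‖Wε x - cε‖ ^ 2 + 3 * ‖cε - c‖ ^ 2 := by
        intro x
        have e : W x - c = (Wε x - cε) + (cε - c) - (Wε x - W x) := by abel
        have h1 := norm_sub_le ((Wε x - cε) + (cε - c)) (Wε x - W x)
        have h2 := norm_add_le (Wε x - cε) (cε - c)
        rw [← e] at h1
        have h3 : ‖W x - c‖ ≤ ‖Wε x - W x‖ + ‖Wε x - cε‖ + ‖cε - c‖ := by linarith
        have h4 : ‖W x - c‖ ^ 2 ≤ (‖Wε x - W x‖ + ‖Wε x - cε‖ + ‖cε - c‖) ^ 2 :=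
          pow_le_pow_left₀ (norm_nonneg _) h3 2
        nlinarith [sq_nonneg (‖Wε x - W x‖ - ‖Wε x - cε‖), sq_nonneg (‖Wε x - cε‖ - ‖cε - c‖),
          sq_nonneg (‖Wε x - W x‖ - ‖cε - c‖)]
      have hca : Continuous fun x => ‖Wε x - W x‖ ^ 2 := (hWεc.sub hWc).norm.pow 2
      have hcb : Continuous fun x => ‖Wε x - cε‖ ^ 2 := (hWεc.sub continuous_const).norm.pow 2
      have hia : Integrable (fun x => 3 * ‖Wε x - W x‖ ^ 2) volume :=
        (hca.const_mul 3).integrable_unitAddTorus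
      have hib : Integrable (fun x => 3 * ‖Wε x - cε‖ ^ 2) volume :=
        (hcb.const_mul 3).integrable_unitAddTorus
      have hicc : Integrable (fun _ : UnitAddTorus d => 3 * ‖cε - c‖ ^ 2) volume :=
        integrable_const _
      have hiab : Integrable (fun x => 3 * ‖Wε x - W x‖ ^ 2 + 3 * ‖Wε x - cε‖ ^ 2) volume :=
        hia.add hib
      have hiV : Integrable (fun x => ‖W x - c‖ ^ 2) volume :=
        ((hWc.sub continuous_const).norm.pow 2).integrable_unitAddTorus
      calc V ≤ ∫ x, (3 * ‖Wε x - W x‖ ^ 2 + 3 * ‖Wε x - cε‖ ^ 2 + 3 * ‖cε - c‖ ^ 2) :=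
            integral_mono hiV (hiab.add hicc) hpt
        _ = 3 * (∫ x, ‖Wε x - W x‖ ^ 2) + 3 * (∫ x, ‖Wε x - cε‖ ^ 2) + 3 * ‖cε - c‖ ^ 2 := by
            rw [integral_add hiab hicc, integral_add hia hib, integral_const_mul, integral_const_mul,
              integral_const]
            simp
    have e1 : D3 * (9 * (I + ε * (2 * J + Z))) = 9 * (D3 * I) + ε * (9 * (D3 * (2 * J + Z))) := by
      ring
    rw [e1] at hcP
    have e2 : 27 * D3 * I + ε * (6 * K + 27 * D3 * (2 * J + Z)) =
        6 * (ε * K) + 3 * (9 * (D3 * I) + ε * (9 * (D3 * (2 * J + Z)))) := by ring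
    rw [e2]
    linarith [hsplit, ha, hb, hcP]
  -- `ε → 0`
  have hVle : V ≤ 27 * D3 * I := by
    refine le_of_forall_pos_lt_add fun η hη => ?_
    obtain ⟨B, hB⟩ : ∃ B : ℝ, B = 6 * K + 27 * D3 * (2 * J + Z) := ⟨_, rfl⟩
    have hB0 : 0 ≤ B := by rw [hB]; positivity
    have hB1 : 0 < B + 1 := by linarith
    obtain ⟨ε, hεdef⟩ : ∃ ε : ℝ, ε = min 1 (η / (B + 1)) := ⟨_, rfl⟩
    have hε0 : 0 < ε := by rw [hεdef]; exact lt_min one_pos (div_pos hη hB1)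
    have hε1 : ε ≤ 1 := by rw [hεdef]; exact min_le_left _ _
    have hεη : ε * B < η := by
      have h1 : ε ≤ η / (B + 1) := by rw [hεdef]; exact min_le_right _ _
      have h2 : η / (B + 1) * B < η := by
        rw [div_mul_eq_mul_div, div_lt_iff₀ hB1]
        have : η * (B + 1) = η * B + η := by ring
        rw [this]; linarith
      calc ε * B ≤ η / (B + 1) * B := mul_le_mul_of_nonneg_right h1 hB0
        _ < η := h2
    have h := hVε ε hε0 hε1
    rw [← hB] at h
    linarith
  calc ∫ x, ‖u x‖ ^ 6 = ∫ x, ‖W x‖ ^ 2 := hU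
    _ ≤ 1460 * V := hUV
    _ ≤ 1460 * (27 * D3 * I) := by gcongr
    _ = 39420 * D3 * I := by ring

end VelocityL6

end Summit.NavierStokesRegularity.FunctionalMining
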